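import Literature.Analysis.FluidPDE.RieszPressureL3
import Literature.Analysis.FluidPDE.LerayHopf
import HarnessLib

/-!
# The Riesz pressure along a `C([0,S]; L³)` curve: a jointly measurable space–time representative

Analysis/FluidPDE proof file in the DAG below the named fact
`Literature.Analysis.FluidPDE.kato_distributional_slab` (**D** of `KatoLocalLerayPressure.lean`:
a Kato solution `u ∈ C([0,T); L³)` solves the Navier–Stokes equations in the sense of
distributions on the open slab `(0, S) × ℝ³`, `S < T`, with the Riesz pressure, which lies in
`L^{3/2}((0,S) × ℝ³)`). In print (Lemarié-Rieusset 2016, Prop. 6.5 with Def. 6.9 and Prop. 6.2,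
file p. 136 / p. 130 of the held copy) the pressure of a very weak solution in
`L^∞((0,S), L³)` is `p = Σᵢⱼ ℛᵢℛⱼ(uᵢuⱼ) ∈ L^∞((0,S), L^{3/2})`. The tree has the slice operator
`Π = rieszPressure : L³ → L^{3/2}` with its `L^{3/2}` bound, its continuity and the weak Poisson
equation (`RieszPressureL3.lean`); this file supplies the **function of `(t, x)`**: the family
`t ↦ Π[u(t)]` is only defined slice by slice up to null sets, and the space–time formulation
(`IsDistributionalNSSolutionOn`: `p` locally integrable on the slab, `∫∫ p div ψ`) needs one
jointly measurable representative.

* `exists_spaceTime_rieszPressure` — for `0 < S` and `u ∈ C([0,S]; L³)` (`ContinuousInLpOn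
  (Icc 0 S) 3 u`) there is `p : ℝ → ℝ³ → ℝ`, jointly measurable on `(0,S) × ℝ³`, in
  `L^{3/2}((0,S) × ℝ³)`, with, for a.e. `t ∈ (0,S)`: `p(t) = Π[u(t)]` a.e., `p(t) ∈ L^{3/2}`,
  `‖p(t)‖_{L^{3/2}} ≤ C_{3/2} ‖u(t)‖²_{L³}` (Stein), and `∫ p(t) Δφ = -∫ D²φ(u(t), u(t))` for every test
  function `φ`.

## Construction

`Π` is Lipschitz on bounded subsets of `L³` (`eLpNorm_rieszPressure_sub_le_mul`: the tree's
bilinear estimate with the optimal parameter), and `t ↦ u(t)` is uniformly continuous and bounded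
in `L³` on the compact `[0, S]` (`ContinuousInLpOn.exists_forall_eLpNorm_sub_lt`,
`.exists_forall_eLpNorm_le_Icc`, through the `L³`-valued curve and
`IsCompact.uniformContinuousOn_of_continuous`). Hence the **step approximants**
`P_n(t, ·) = Π[u(t_k)]` on the cells `[t_k, t_{k+1})` of the uniform grid (`stepRieszPressure`; finite
sums of products of a time indicator and a fixed `L^{3/2}` function, so jointly measurable for
free) converge to `Π[u(t)]` in `L^{3/2}` uniformly in `t ∈ [0, S)`
(`tendsto_iSup_eLpNorm_stepRieszPressure_sub`). By Tonelli the space–time `L^{3/2}` distance of two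
approximants is at most `S^{2/3}` times the sum of the uniform slice distances
(`eLpNorm_stepRieszPressure_sub_le`), so along a fast subsequence the `P_n` are Cauchy in
`L^{3/2}((0,S) × ℝ³)` with summable rate; they converge a.e. on the slab
(`MeasureTheory.Lp.ae_tendsto_of_cauchy_eLpNorm`) to a jointly measurable limit
(`exists_stronglyMeasurable_limit_of_tendsto_ae`), whose slices are identified with `Π[u(t)]` for
a.e. `t` through convergence in measure (`Measure.ae_ae_of_ae_prod`,
`TendstoInMeasure.exists_seq_tendsto_ae`): `exists_stronglyMeasurable_slice_ae_eq_rieszPressure`.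
The classes and the Poisson equation are then read off the slice theory.

## Mathlib / tree search

Tree (all used): `rieszPressure`, `memLp_rieszPressure`, `eLpNorm_rieszPressure_le`,
`eLpNorm_rieszPressure_sub_le`, `rieszPressure_congr_ae`, `aestronglyMeasurable_rieszPressure`,
`rieszPressure_eq_zero_of_not_memLp`, `integral_rieszPressure_mul_laplacian`, `steinConstThreeHalves`
(`RieszPressureL3.lean`); `ContinuousInLpOn` (`LerayHopf.lean`). `lean search
'volume_restrict_prod_univ_eq_prod|exists_forall_eLpNorm_le'`: the slab/product identity exists in
`KatoUniquenessDual.lean` and a compact-set `L^p` bound in `KatoL3Uniqueness.lean`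
(`ContinuousInLpOn.exists_forall_eLpNorm_le`); both are re-derived here in a few lines (private /
`_Icc`) to keep the import closure at `RieszPressureL3`. Mathlib: `MemLp.toLp`, `Lp.norm_toLp`,
`IsCompact.uniformContinuousOn_of_continuous`, `Metric.uniformContinuousOn_iff`,
`extraction_forall_of_eventually'`, `MeasureTheory.Lp.ae_tendsto_of_cauchy_eLpNorm`,
`exists_stronglyMeasurable_limit_of_tendsto_ae`, `Measure.ae_ae_of_ae_prod`, `Measure.prod_restrict`,
`tendstoInMeasure_of_tendsto_eLpNorm`, `TendstoInMeasure.exists_seq_tendsto_ae`, `lintegral_prod`,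
`ENNReal.tsum_geometric`.

## References

* P. G. Lemarié-Rieusset, *The Navier–Stokes Problem in the 21st Century*, CRC Press 2016,
  doi:10.1201/b19556 (file pages of the held copy): Prop. 6.2 (p. 130), Prop. 6.5 and Def. 6.9
  (p. 136). [LemarieRieusset2016]
* E. M. Stein, *Singular integrals and differentiability properties of functions* (1970), Ch. II
  §4.2 Thm. 3. [Stein1971]
* T.-P. Tsai, Arch. Rational Mech. Anal. 143 (1998), Lemma 2.1 and its proof (p. 34). [Tsai1998]
-/

noncomputable section

open MeasureTheory TopologicalSpace Set Function Filter Topology Metric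
open scoped ENNReal NNReal RealInnerProductSpace Laplacian

namespace Literature.Analysis.FluidPDE

/-- Local notation for physical space `ℝ³ = EuclideanSpace ℝ (Fin 3)`. -/
local notation "ℝ³" => EuclideanSpace ℝ (Fin 3)

/-- `1 ≤ 3` as a `Fact`, to speak of the normed space `L³`. [folklore] -/
private instance fact_one_le_three_ennreal : Fact ((1 : ℝ≥0∞) ≤ 3) := ⟨by norm_num⟩

/-! ### A linear (local Lipschitz) form of the bilinear estimate -/

section Lipschitz

variable {v w : ℝ³ → ℝ³}

/-- **`Π` is Lipschitz on bounded sets of `L³`**: for `‖v‖₃, ‖w‖₃ ≤ M`,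
`‖Π[v] - Π[w]‖_{L^{3/2}} ≤ 4 C_{3/2} (1 + (2M)²) ‖v - w‖_{L³}` (the bilinear estimate
`eLpNorm_rieszPressure_sub_le` with the optimal parameter `t² = 1/‖v - w‖₃`).
[cite: Tsai1998, Lemma 2.1 proof (p. 34)] -/
theorem eLpNorm_rieszPressure_sub_le_mul (hv : MemLp v 3 volume) (hw : MemLp w 3 volume)
    {M : ℝ≥0∞} (hvM : eLpNorm v 3 volume ≤ M) (hwM : eLpNorm w 3 volume ≤ M) :
    eLpNorm (rieszPressure v - rieszPressure w) (3 / 2 : ℝ≥0∞) volume ≤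
      4 * steinConstThreeHalves * (1 + (2 * M) ^ 2) * eLpNorm (v - w) 3 volume := by
  set d : ℝ≥0∞ := eLpNorm (v - w) 3 volume with hd
  have hdtop : d ≠ ⊤ := (hv.sub hw).eLpNorm_ne_top
  rcases eq_or_ne d 0 with hd0 | hd0
  · -- `v = w` a.e.
    have hvw : v =ᵐ[volume] w := by
      have h : v - w =ᵐ[volume] 0 :=
        (eLpNorm_eq_zero_iff (hv.1.sub hw.1) (by norm_num : (3 : ℝ≥0∞) ≠ 0)).1 hd0
      filter_upwards [h] with x hx
      exact sub_eq_zero.1 hx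
    have hPi : rieszPressure v =ᵐ[volume] rieszPressure w := rieszPressure_congr_ae hvw hw
    have h0 : eLpNorm (rieszPressure v - rieszPressure w) (3 / 2 : ℝ≥0∞) volume = 0 := by
      rw [eLpNorm_congr_ae (hPi.sub (EventuallyEq.refl _ (rieszPressure w))), sub_self, eLpNorm_zero]
    rw [h0]
    exact bot_le
  -- `0 < d < ∞`: the parameter `t = d.toReal^{-1/2}`
  have hdpos : 0 < d.toReal := ENNReal.toReal_pos hd0 hdtop
  set t : ℝ := 1 / Real.sqrt d.toReal with ht
  have htpos : 0 < t := by positivity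
  have ht2 : t ^ 2 = d.toReal⁻¹ := by
    rw [ht, div_pow, one_pow, Real.sq_sqrt hdpos.le, one_div]
  have ht2' : t⁻¹ ^ 2 = d.toReal := by
    rw [ht, inv_div, div_one, Real.sq_sqrt hdpos.le]
  have h := eLpNorm_rieszPressure_sub_le hv hw htpos
  have e1 : ENNReal.ofReal (t ^ 2) * eLpNorm (v - w) 3 volume ^ 2 = d := by
    rw [ht2, ENNReal.ofReal_inv_of_pos hdpos, ENNReal.ofReal_toReal hdtop, ← hd, sq, ← mul_assoc,
      ENNReal.inv_mul_cancel hd0 hdtop, one_mul]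
  have e2 : ENNReal.ofReal (t⁻¹ ^ 2) = d := by rw [ht2', ENNReal.ofReal_toReal hdtop]
  have hsum : eLpNorm (v + w) 3 volume ≤ 2 * M :=
    calc eLpNorm (v + w) 3 volume ≤ eLpNorm v 3 volume + eLpNorm w 3 volume :=
          eLpNorm_add_le hv.1 hw.1 (by norm_num)
      _ ≤ M + M := add_le_add hvM hwM
      _ = 2 * M := (two_mul M).symm
  calc eLpNorm (rieszPressure v - rieszPressure w) (3 / 2 : ℝ≥0∞) volume
      ≤ 4 * steinConstThreeHalves * (d + d * eLpNorm (v + w) 3 volume ^ 2) := by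
        rw [e1, e2] at h; exact h
    _ ≤ 4 * steinConstThreeHalves * (d + d * (2 * M) ^ 2) := by gcongr
    _ = 4 * steinConstThreeHalves * (1 + (2 * M) ^ 2) * eLpNorm (v - w) 3 volume := by
        rw [← hd]; ring

end Lipschitz

/-! ### Uniform continuity and boundedness of a `C([0,S]; L³)` curve -/

section Curve

variable {S : ℝ} {u : ℝ → ℝ³ → ℝ³}

/-- The `L³`-valued map of a `C([0,S]; L³)` curve (zero off `[0, S]`). [folklore] -/
private def curveLp (hu : ContinuousInLpOn (Icc 0 S) 3 u) (t : ℝ) : Lp ℝ³ 3 (volume : Measure ℝ³) :=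
  if ht : t ∈ Icc 0 S then (hu.1 t ht).toLp (u t) else 0

/-- Unfolding `curveLp` on `[0, S]`. [folklore] -/
private theorem curveLp_of_mem (hu : ContinuousInLpOn (Icc 0 S) 3 u) {t : ℝ} (ht : t ∈ Icc 0 S) :
    curveLp hu t = (hu.1 t ht).toLp (u t) := by
  simp [curveLp, ht]

/-- Distances along the `L³` curve are `L³` norms of differences of slices. [folklore] -/
private theorem dist_curveLp (hu : ContinuousInLpOn (Icc 0 S) 3 u) {s t : ℝ} (hs : s ∈ Icc 0 S)
    (ht : t ∈ Icc 0 S) :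
    dist (curveLp hu s) (curveLp hu t) = (eLpNorm (u s - u t) 3 volume).toReal := by
  rw [curveLp_of_mem hu hs, curveLp_of_mem hu ht, dist_eq_norm, ← MemLp.toLp_sub, Lp.norm_toLp]

/-- Norms along the `L³` curve are `L³` norms of slices. [folklore] -/
private theorem norm_curveLp (hu : ContinuousInLpOn (Icc 0 S) 3 u) {t : ℝ} (ht : t ∈ Icc 0 S) :
    ‖curveLp hu t‖ = (eLpNorm (u t) 3 volume).toReal := by
  rw [curveLp_of_mem hu ht, Lp.norm_toLp]

/-- The `L³` curve is continuous on `[0, S]` (this is `ContinuousInLpOn`). [folklore] -/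
private theorem continuousOn_curveLp (hu : ContinuousInLpOn (Icc 0 S) 3 u) :
    ContinuousOn (curveLp hu) (Icc 0 S) := by
  intro t₀ ht₀
  rw [ContinuousWithinAt, Metric.tendsto_nhds]
  intro ε hε
  have h := hu.2 t₀ ht₀
  have hev : ∀ᶠ t in 𝓝[Icc 0 S] t₀, eLpNorm (u t - u t₀) 3 volume < ENNReal.ofReal ε :=
    h (gt_mem_nhds (ENNReal.ofReal_pos.2 hε))
  have hmem : ∀ᶠ t in 𝓝[Icc 0 S] t₀, t ∈ Icc 0 S := self_mem_nhdsWithin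
  filter_upwards [hev, hmem] with t h1 h2
  rw [dist_curveLp hu h2 ht₀]
  exact ENNReal.toReal_lt_of_lt_ofReal h1

/-- **Uniform continuity in `L³` on the compact time interval**: for every `ε > 0` there is
`δ > 0` with `‖u(s) - u(t)‖_{L³} < ε` whenever `s, t ∈ [0, S]`, `|s - t| < δ`. [folklore] -/
theorem ContinuousInLpOn.exists_forall_eLpNorm_sub_lt (hu : ContinuousInLpOn (Icc 0 S) 3 u)
    {ε : ℝ} (hε : 0 < ε) :
    ∃ δ > 0, ∀ s ∈ Icc 0 S, ∀ t ∈ Icc 0 S, |s - t| < δ →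
      eLpNorm (u s - u t) 3 volume < ENNReal.ofReal ε := by
  have hU := isCompact_Icc.uniformContinuousOn_of_continuous (continuousOn_curveLp hu)
  rw [Metric.uniformContinuousOn_iff] at hU
  obtain ⟨δ, hδ, hδ'⟩ := hU ε hε
  refine ⟨δ, hδ, fun s hs t ht hst => ?_⟩
  have h := hδ' s hs t ht (by rwa [Real.dist_eq])
  rw [dist_curveLp hu hs ht] at h
  exact (ENNReal.lt_ofReal_iff_toReal_lt ((hu.1 s hs).sub (hu.1 t ht)).eLpNorm_ne_top).2 h

/-- **Boundedness in `L³` on the compact time interval.** [folklore] -/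
theorem ContinuousInLpOn.exists_forall_eLpNorm_le_Icc (hu : ContinuousInLpOn (Icc 0 S) 3 u) :
    ∃ M : ℝ≥0, ∀ t ∈ Icc 0 S, eLpNorm (u t) 3 volume ≤ M := by
  obtain ⟨R, hR⟩ := (isCompact_Icc.image_of_continuousOn (continuousOn_curveLp hu)).isBounded.exists_norm_le
  refine ⟨(max R 0).toNNReal, fun t ht => ?_⟩
  have h := hR _ (mem_image_of_mem _ ht)
  rw [norm_curveLp hu ht] at h
  have hne : eLpNorm (u t) 3 volume ≠ ⊤ := (hu.1 t ht).eLpNorm_ne_top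
  rw [← ENNReal.ofReal_toReal hne, show ((max R 0).toNNReal : ℝ≥0∞) = ENNReal.ofReal (max R 0) by
    rw [ENNReal.ofReal]]
  exact ENNReal.ofReal_le_ofReal (h.trans (le_max_left R 0))

end Curve

/-! ### Step approximants of the space–time pressure -/

section Step

variable {S : ℝ} {u : ℝ → ℝ³ → ℝ³}

/-- The uniform time grid `t_k = k S/(n+1)`. [folklore] -/
def timeGrid (S : ℝ) (n k : ℕ) : ℝ := k * (S / (n + 1))

/-- The `k`-th time cell `[t_k, t_{k+1})` of the grid. [folklore] -/
def timeCell (S : ℝ) (n k : ℕ) : Set ℝ := Ico (timeGrid S n k) (timeGrid S n (k + 1))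

/-- **The step approximant of the space–time Riesz pressure**: on the `k`-th time cell it is the
Riesz pressure `Π[u(t_k)]` of the slice at the left grid point (a finite sum of products of a
time indicator and a fixed `L^{3/2}` function, hence trivially jointly measurable). [folklore] -/
def stepRieszPressure (u : ℝ → ℝ³ → ℝ³) (S : ℝ) (n : ℕ) (t : ℝ) (x : ℝ³) : ℝ :=
  ∑ k ∈ Finset.range (n + 1),
    (timeCell S n k).indicator (fun _ => (1 : ℝ)) t * rieszPressure (u (timeGrid S n k)) x

/-- The Riesz pressure of any field is a.e. strongly measurable (it is `0` off `L³`). [folklore] -/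
theorem aestronglyMeasurable_rieszPressure' (w : ℝ³ → ℝ³) :
    AEStronglyMeasurable (rieszPressure w) volume := by
  by_cases hw : MemLp w 3 volume
  · exact aestronglyMeasurable_rieszPressure hw
  · rw [rieszPressure_eq_zero_of_not_memLp hw]
    exact aestronglyMeasurable_zero

/-- The step approximant is jointly a.e. strongly measurable on `ℝ × ℝ³`. [folklore] -/
theorem aestronglyMeasurable_uncurry_stepRieszPressure (u : ℝ → ℝ³ → ℝ³) (S : ℝ) (n : ℕ) :
    AEStronglyMeasurable (uncurry (stepRieszPressure u S n)) (volume : Measure (ℝ × ℝ³)) := by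
  have e : uncurry (stepRieszPressure u S n) = fun z : ℝ × ℝ³ => ∑ k ∈ Finset.range (n + 1),
      (timeCell S n k).indicator (fun _ => (1 : ℝ)) z.1 * rieszPressure (u (timeGrid S n k)) z.2 := by
    funext z; rfl
  rw [e]
  refine Finset.aestronglyMeasurable_fun_sum _ fun k _ => ?_
  have h1 : AEStronglyMeasurable (fun z : ℝ × ℝ³ => (timeCell S n k).indicator (fun _ => (1 : ℝ)) z.1)
      (volume : Measure (ℝ × ℝ³)) :=
    ((measurable_const.indicator measurableSet_Ico).comp measurable_fst).aestronglyMeasurable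
  have h2 : AEStronglyMeasurable (fun z : ℝ × ℝ³ => rieszPressure (u (timeGrid S n k)) z.2)
      (volume : Measure (ℝ × ℝ³)) := by
    rw [show (volume : Measure (ℝ × ℝ³)) = (volume : Measure ℝ).prod (volume : Measure ℝ³) from rfl]
    exact (aestronglyMeasurable_rieszPressure' _).comp_snd
  exact h1.mul h2

/-- Every slice of the step approximant is a.e. strongly measurable. [folklore] -/
theorem aestronglyMeasurable_stepRieszPressure_slice (u : ℝ → ℝ³ → ℝ³) (S : ℝ) (n : ℕ) (t : ℝ) :
    AEStronglyMeasurable (stepRieszPressure u S n t) (volume : Measure ℝ³) := by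
  have e : stepRieszPressure u S n t = fun x : ℝ³ => ∑ k ∈ Finset.range (n + 1),
      (timeCell S n k).indicator (fun _ => (1 : ℝ)) t * rieszPressure (u (timeGrid S n k)) x := by
    funext x; rfl
  rw [e]
  exact Finset.aestronglyMeasurable_fun_sum _ fun k _ =>
    aestronglyMeasurable_const.mul (aestronglyMeasurable_rieszPressure' _)

/-- **Evaluation of the step approximant**: for `0 ≤ t < S` there is a grid point `s ∈ [0, S]`
with `|s - t| ≤ S/(n+1)` and `P_n(t, ·) = Π[u(s)]`. [folklore] -/
theorem exists_stepRieszPressure_eq (hS : 0 < S) (n : ℕ) {t : ℝ} (ht : t ∈ Ico 0 S) :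
    ∃ s ∈ Icc 0 S, |s - t| ≤ S / (n + 1) ∧
      stepRieszPressure u S n t = rieszPressure (u s) := by
  set h : ℝ := S / (n + 1) with hh
  have hpos : 0 < h := by positivity
  set k₀ : ℕ := ⌊t / h⌋₊ with hk₀
  have ht0 : 0 ≤ t / h := div_nonneg ht.1 hpos.le
  have hk₀le : (k₀ : ℝ) ≤ t / h := Nat.floor_le ht0
  have hk₀lt : t / h < k₀ + 1 := Nat.lt_floor_add_one _
  have hmem : t ∈ timeCell S n k₀ := by
    refine ⟨?_, ?_⟩
    · show (k₀ : ℝ) * (S / (n + 1)) ≤ t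
      rw [← hh]; rwa [le_div_iff₀ hpos] at hk₀le
    · show t < ((k₀ + 1 : ℕ) : ℝ) * (S / (n + 1))
      rw [← hh]; push_cast; rwa [div_lt_iff₀ hpos] at hk₀lt
  have hk₀n : k₀ < n + 1 := by
    have h1 : (k₀ : ℝ) < n + 1 := by
      refine hk₀le.trans_lt ?_
      rw [div_lt_iff₀ hpos, hh]
      field_simp
      nlinarith [ht.2]
    exact_mod_cast h1
  have huniq : ∀ k, t ∈ timeCell S n k → k = k₀ := by
    intro k hk
    obtain ⟨hk1, hk2⟩ := hk
    change (k : ℝ) * (S / (n + 1)) ≤ t at hk1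
    change t < ((k + 1 : ℕ) : ℝ) * (S / (n + 1)) at hk2
    push_cast at hk2
    rw [← hh] at hk1 hk2
    rw [hk₀, eq_comm, Nat.floor_eq_iff ht0]
    exact ⟨by rwa [le_div_iff₀ hpos], by rwa [div_lt_iff₀ hpos]⟩
  refine ⟨timeGrid S n k₀, ⟨by simp only [timeGrid]; positivity, ?_⟩, ?_, ?_⟩
  · -- `t_{k₀} ≤ S`
    calc timeGrid S n k₀ ≤ t := hmem.1
      _ ≤ S := ht.2.le
  · rw [abs_sub_comm, abs_of_nonneg (sub_nonneg.2 hmem.1)]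
    have : t < timeGrid S n k₀ + h := by
      have h2 := hmem.2
      simp only [timeGrid, Nat.cast_add, Nat.cast_one, add_mul, one_mul] at h2 ⊢
      rw [hh]; exact h2
    linarith
  · funext x
    change ∑ k ∈ Finset.range (n + 1),
      (timeCell S n k).indicator (fun _ => (1 : ℝ)) t * rieszPressure (u (timeGrid S n k)) x = _
    rw [Finset.sum_eq_single k₀]
    · rw [indicator_of_mem hmem, one_mul]
    · intro k _ hk
      rw [indicator_of_notMem (fun h => hk (huniq k h)), zero_mul]
    · intro hk
      exact absurd (Finset.mem_range.2 hk₀n) hk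

end Step

/-! ### Uniform convergence of the step approximants to the slice pressures -/

section Uniform

variable {S : ℝ} {u : ℝ → ℝ³ → ℝ³}

/-- **Uniform-in-time convergence**: `sup_{0 ≤ t < S} ‖P_n(t,·) - Π[u(t)]‖_{L^{3/2}} → 0` for a
`C([0,S]; L³)` curve (Lipschitz bound for `Π` on the bounded curve and uniform continuity of the
curve). [folklore] -/
theorem tendsto_iSup_eLpNorm_stepRieszPressure_sub (hS : 0 < S) (hu : ContinuousInLpOn (Icc 0 S) 3 u) :
    Tendsto (fun n => ⨆ t ∈ Ico 0 S,
      eLpNorm (stepRieszPressure u S n t - rieszPressure (u t)) (3 / 2 : ℝ≥0∞) volume) atTop (𝓝 0) := by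
  obtain ⟨M, hM⟩ := hu.exists_forall_eLpNorm_le_Icc
  set K : ℝ≥0∞ := 4 * steinConstThreeHalves * (1 + (2 * (M : ℝ≥0∞)) ^ 2) with hK
  have hKtop : K ≠ ⊤ := by
    refine ENNReal.mul_ne_top (ENNReal.mul_ne_top (by norm_num) ENNReal.coe_ne_top)
      (ENNReal.add_ne_top.2 ⟨ENNReal.one_ne_top, ENNReal.pow_ne_top
        (ENNReal.mul_ne_top (by norm_num) ENNReal.coe_ne_top)⟩)
  -- the slice bound through the Lipschitz estimate
  have hslice : ∀ n : ℕ, ∀ t ∈ Ico 0 S, ∃ s ∈ Icc 0 S, |s - t| ≤ S / (n + 1) ∧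
      eLpNorm (stepRieszPressure u S n t - rieszPressure (u t)) (3 / 2 : ℝ≥0∞) volume ≤
        K * eLpNorm (u s - u t) 3 volume := by
    intro n t ht
    obtain ⟨s, hs, hst, he⟩ := exists_stepRieszPressure_eq (u := u) hS n ht
    refine ⟨s, hs, hst, ?_⟩
    rw [he]
    have ht' : t ∈ Icc 0 S := Ico_subset_Icc_self ht
    exact eLpNorm_rieszPressure_sub_le_mul (hu.1 s hs) (hu.1 t ht') (hM s hs) (hM t ht')
  rw [ENNReal.tendsto_atTop_zero]
  intro ε hε
  -- choose the `L³`-modulus `ρ` with `K ρ ≤ ε`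
  obtain ⟨ρ, hρ, hKρ⟩ : ∃ ρ : ℝ, 0 < ρ ∧ K * ENNReal.ofReal ρ ≤ ε := by
    rcases eq_or_ne ε ⊤ with rfl | hεtop
    · exact ⟨1, one_pos, le_top⟩
    · have hεpos : 0 < ε.toReal := ENNReal.toReal_pos hε.ne' hεtop
      refine ⟨ε.toReal / (K.toReal + 1), by positivity, ?_⟩
      have hKt : 0 ≤ K.toReal := ENNReal.toReal_nonneg
      calc K * ENNReal.ofReal (ε.toReal / (K.toReal + 1))
          = ENNReal.ofReal K.toReal * ENNReal.ofReal (ε.toReal / (K.toReal + 1)) := by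
            rw [ENNReal.ofReal_toReal hKtop]
        _ = ENNReal.ofReal (K.toReal * (ε.toReal / (K.toReal + 1))) := (ENNReal.ofReal_mul hKt).symm
        _ ≤ ENNReal.ofReal ε.toReal := by
            refine ENNReal.ofReal_le_ofReal ?_
            rw [mul_div_assoc', div_le_iff₀ (by positivity)]
            nlinarith
        _ = ε := ENNReal.ofReal_toReal hεtop
  obtain ⟨δ, hδ, hδ'⟩ := hu.exists_forall_eLpNorm_sub_lt hρ
  -- `S/(n+1) < δ` for `n ≥ N`
  obtain ⟨N, hN⟩ := exists_nat_gt (S / δ)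
  refine ⟨N, fun n hn => ?_⟩
  have hSn : S / (n + 1) < δ := by
    rw [div_lt_iff₀ (by positivity)]
    rw [div_lt_iff₀ hδ] at hN
    have : (N : ℝ) ≤ n := by exact_mod_cast hn
    nlinarith
  refine iSup₂_le fun t ht => ?_
  obtain ⟨s, hs, hst, hle⟩ := hslice n t ht
  refine hle.trans ((mul_le_mul_right (hδ' s hs t (Ico_subset_Icc_self ht)
    (hst.trans_lt hSn)).le _).trans hKρ)

end Uniform

/-! ### The space–time limit -/

section Limit

variable {S : ℝ} {u : ℝ → ℝ³ → ℝ³}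

/-- The restricted Lebesgue measure on the slab `(0,S) × ℝ³` is the product of the restricted
time measure with Lebesgue measure (private twin of `volume_restrict_prod_univ_eq_prod`,
`KatoUniquenessDual.lean`). [folklore] -/
private theorem volume_restrict_Ioo_prod_univ_eq_prod (S : ℝ) :
    (volume : Measure (ℝ × ℝ³)).restrict (Ioo 0 S ×ˢ univ) =
      (volume.restrict (Ioo 0 S)).prod (volume : Measure ℝ³) := by
  rw [show (volume : Measure (ℝ × ℝ³)) = (volume : Measure ℝ).prod (volume : Measure ℝ³) from rfl,
    ← Measure.restrict_univ (μ := (volume : Measure ℝ³)), Measure.prod_restrict,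
    Measure.restrict_univ]

/-- `‖f‖_{L^{3/2}}^{3/2} = ∫ |f|^{3/2}` (bookkeeping). [folklore] -/
private theorem lintegral_enorm_rpow_threeHalves_eq {α : Type*} [MeasurableSpace α] (μ : Measure α)
    (f : α → ℝ) : ∫⁻ x, ‖f x‖ₑ ^ (3 / 2 : ℝ) ∂μ = eLpNorm f (3 / 2 : ℝ≥0∞) μ ^ (3 / 2 : ℝ) := by
  have h32 : (3 / 2 : ℝ≥0∞) ≠ 0 := by norm_num
  have h32' : (3 / 2 : ℝ≥0∞) ≠ ⊤ := by
    rw [ENNReal.div_eq_inv_mul]; exact ENNReal.mul_ne_top (by simp) (by simp)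
  have e : (3 / 2 : ℝ≥0∞).toReal = 3 / 2 := by rw [ENNReal.toReal_div]; norm_num
  rw [eLpNorm_eq_lintegral_rpow_enorm_toReal h32 h32', e, ← ENNReal.rpow_mul]
  norm_num

/-- **Space–time `L^{3/2}` distance of two step approximants** in terms of the uniform slice
distances: `‖P_n - P_m‖_{L^{3/2}((0,S)×ℝ³)} ≤ S^{2/3} (D_n + D_m)`. [folklore] -/
theorem eLpNorm_stepRieszPressure_sub_le (n m : ℕ) {Dn Dm : ℝ≥0∞}
    (hn : ∀ t ∈ Ico 0 S, eLpNorm (stepRieszPressure u S n t - rieszPressure (u t)) (3 / 2 : ℝ≥0∞) volume ≤ Dn)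
    (hm : ∀ t ∈ Ico 0 S, eLpNorm (stepRieszPressure u S m t - rieszPressure (u t)) (3 / 2 : ℝ≥0∞) volume ≤ Dm) :
    eLpNorm (uncurry (stepRieszPressure u S n) - uncurry (stepRieszPressure u S m)) (3 / 2 : ℝ≥0∞)
        (volume.restrict (Ioo 0 S ×ˢ (univ : Set ℝ³))) ≤
      ENNReal.ofReal S ^ (2 / 3 : ℝ) * (Dn + Dm) := by
  set F : ℝ × ℝ³ → ℝ := uncurry (stepRieszPressure u S n) - uncurry (stepRieszPressure u S m) with hF
  have hFm : AEStronglyMeasurable F (volume : Measure (ℝ × ℝ³)) :=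
    (aestronglyMeasurable_uncurry_stepRieszPressure u S n).sub
      (aestronglyMeasurable_uncurry_stepRieszPressure u S m)
  -- slice bound
  have hsl : ∀ t ∈ Ioo 0 S, ∫⁻ x, ‖F (t, x)‖ₑ ^ (3 / 2 : ℝ) ≤ (Dn + Dm) ^ (3 / 2 : ℝ) := by
    intro t ht
    have ht' : t ∈ Ico 0 S := ⟨ht.1.le, ht.2⟩
    have e : (fun x => F (t, x)) = stepRieszPressure u S n t - stepRieszPressure u S m t := by
      funext x; rfl
    rw [lintegral_enorm_rpow_threeHalves_eq, e]
    refine ENNReal.rpow_le_rpow ?_ (by norm_num)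
    have e2 : stepRieszPressure u S n t - stepRieszPressure u S m t =
        (stepRieszPressure u S n t - rieszPressure (u t)) -
          (stepRieszPressure u S m t - rieszPressure (u t)) := by abel
    rw [e2]
    have h1 : (1 : ℝ≥0∞) ≤ 3 / 2 :=
      ((ENNReal.lt_div_iff_mul_lt (Or.inl (by norm_num)) (Or.inl (by norm_num))).2 (by norm_num)).le
    have hm1 : AEStronglyMeasurable (stepRieszPressure u S n t - rieszPressure (u t)) volume :=
      (aestronglyMeasurable_stepRieszPressure_slice u S n t).sub (aestronglyMeasurable_rieszPressure' _)
    have hm2 : AEStronglyMeasurable (stepRieszPressure u S m t - rieszPressure (u t)) volume :=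
      (aestronglyMeasurable_stepRieszPressure_slice u S m t).sub (aestronglyMeasurable_rieszPressure' _)
    exact (eLpNorm_sub_le hm1 hm2 h1).trans (add_le_add (hn t ht') (hm t ht'))
  -- integrate in time
  have h32 : (3 / 2 : ℝ≥0∞) ≠ 0 := by norm_num
  have h32' : (3 / 2 : ℝ≥0∞) ≠ ⊤ := by
    rw [ENNReal.div_eq_inv_mul]; exact ENNReal.mul_ne_top (by simp) (by simp)
  have e32 : (3 / 2 : ℝ≥0∞).toReal = 3 / 2 := by rw [ENNReal.toReal_div]; norm_num
  have hFm' : AEStronglyMeasurable F ((volume.restrict (Ioo 0 S)).prod (volume : Measure ℝ³)) :=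
    hFm.mono_measure (by rw [← volume_restrict_Ioo_prod_univ_eq_prod]; exact Measure.restrict_le_self)
  rw [eLpNorm_eq_lintegral_rpow_enorm_toReal h32 h32', e32, volume_restrict_Ioo_prod_univ_eq_prod,
    lintegral_prod _ (hFm'.aemeasurable.enorm.pow_const _)]
  · calc (∫⁻ t in Ioo 0 S, ∫⁻ x, ‖F (t, x)‖ₑ ^ (3 / 2 : ℝ)) ^ (1 / (3 / 2 : ℝ))
        ≤ (∫⁻ _ in Ioo 0 S, (Dn + Dm) ^ (3 / 2 : ℝ)) ^ (1 / (3 / 2 : ℝ)) := by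
          refine ENNReal.rpow_le_rpow (lintegral_mono_ae ?_) (by norm_num)
          filter_upwards [ae_restrict_mem measurableSet_Ioo] with t ht using hsl t ht
      _ = ENNReal.ofReal S ^ (2 / 3 : ℝ) * (Dn + Dm) := by
          rw [lintegral_const, Measure.restrict_apply_univ, Real.volume_Ioo, sub_zero,
            ENNReal.mul_rpow_of_nonneg _ _ (by norm_num), ← ENNReal.rpow_mul]
          norm_num
          rw [mul_comm]

/-- **The space–time Riesz pressure of a `C([0,S]; L³)` curve.** For `0 < S` and
`u ∈ C([0,S]; L³(ℝ³))` there is a (strongly) measurable function `P` on `ℝ × ℝ³` whose slices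
`P(t, ·)` coincide a.e. with the Riesz pressures `Π[u(t)]` for a.e. `t ∈ (0, S)`: the step
approximants `P_n` converge uniformly in `t` slice-wise in `L^{3/2}`, hence (along a fast
subsequence) are Cauchy in `L^{3/2}((0,S) × ℝ³)` with summable rate and converge a.e. on the slab
(`MeasureTheory.Lp.ae_tendsto_of_cauchy_eLpNorm`); the a.e. limit is jointly measurable
(`exists_stronglyMeasurable_limit_of_tendsto_ae`) and its slices are identified through
convergence in measure (`TendstoInMeasure.exists_seq_tendsto_ae`). This is the measurable
representative of `t ↦ Π[u(t)] ∈ C([0,S]; L^{3/2})` needed to speak of the pressure as a function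
of `(t, x)` (Lemarié-Rieusset 2016, Prop. 6.5 / Def. 6.9: `p ∈ L^∞((0,S), L^{3/2})`).
[cite: LemarieRieusset2016, Prop. 6.5 with Def. 6.9 (file p. 136)] -/
theorem exists_stronglyMeasurable_slice_ae_eq_rieszPressure (hS : 0 < S)
    (hu : ContinuousInLpOn (Icc 0 S) 3 u) :
    ∃ P : ℝ × ℝ³ → ℝ, StronglyMeasurable P ∧
      ∀ᵐ t ∂(volume.restrict (Ioo 0 S)), (fun x => P (t, x)) =ᵐ[volume] rieszPressure (u t) := by
  have h1le : (1 : ℝ≥0∞) ≤ 3 / 2 :=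
    ((ENNReal.lt_div_iff_mul_lt (Or.inl (by norm_num)) (Or.inl (by norm_num))).2 (by norm_num)).le
  -- the uniform slice distances
  set D : ℕ → ℝ≥0∞ := fun n => ⨆ t ∈ Ico 0 S,
    eLpNorm (stepRieszPressure u S n t - rieszPressure (u t)) (3 / 2 : ℝ≥0∞) volume with hD_def
  have hD : Tendsto D atTop (𝓝 0) := tendsto_iSup_eLpNorm_stepRieszPressure_sub hS hu
  have hDle : ∀ n, ∀ t ∈ Ico 0 S,
      eLpNorm (stepRieszPressure u S n t - rieszPressure (u t)) (3 / 2 : ℝ≥0∞) volume ≤ D n :=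
    fun n t ht => le_iSup₂ (f := fun t (_ : t ∈ Ico 0 S) =>
      eLpNorm (stepRieszPressure u S n t - rieszPressure (u t)) (3 / 2 : ℝ≥0∞) volume) t ht
  -- a fast subsequence
  have hhalf : ∀ j : ℕ, (0 : ℝ≥0∞) < 2⁻¹ ^ j := fun j => ENNReal.pow_pos (by norm_num) _
  have hex : ∀ j : ℕ, ∃ N, ∀ n ≥ N, D n ≤ (2⁻¹ : ℝ≥0∞) ^ (j + 1) := fun j =>
    ENNReal.tendsto_atTop_zero.1 hD _ (hhalf (j + 1))
  obtain ⟨φ, hφmono, hφ⟩ := extraction_forall_of_eventually' hex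
  -- the approximants along `φ`, on the slab
  set μ' : Measure (ℝ × ℝ³) := volume.restrict (Ioo 0 S ×ˢ (univ : Set ℝ³)) with hμ'
  set f : ℕ → ℝ × ℝ³ → ℝ := fun j => uncurry (stepRieszPressure u S (φ j)) with hf
  have hfm : ∀ j, AEStronglyMeasurable (f j) μ' := fun j =>
    (aestronglyMeasurable_uncurry_stepRieszPressure u S (φ j)).restrict
  -- Cauchy with summable rate
  set W : ℝ≥0∞ := ENNReal.ofReal S ^ (2 / 3 : ℝ) with hW
  have hWtop : W ≠ ⊤ := ENNReal.rpow_ne_top_of_nonneg (by norm_num) ENNReal.ofReal_ne_top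
  set B : ℕ → ℝ≥0∞ := fun N => (W + 1) * 2⁻¹ ^ N with hB_def
  have hB : ∑' N, B N ≠ ⊤ := by
    rw [hB_def, ENNReal.tsum_mul_left, ENNReal.tsum_geometric, ENNReal.one_sub_inv_two, inv_inv]
    exact ENNReal.mul_ne_top (ENNReal.add_ne_top.2 ⟨hWtop, ENNReal.one_ne_top⟩) ENNReal.ofNat_ne_top
  have hcau : ∀ N n m : ℕ, N ≤ n → N ≤ m → eLpNorm (f n - f m) (3 / 2 : ℝ≥0∞) μ' < B N := by
    intro N n m hn hm
    have h := eLpNorm_stepRieszPressure_sub_le (u := u) (S := S) (φ n) (φ m)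
      (hDle (φ n)) (hDle (φ m))
    have hpn : (2⁻¹ : ℝ≥0∞) ^ (n + 1) ≤ 2⁻¹ ^ (N + 1) :=
      pow_le_pow_right_of_le_one' (by norm_num) (by omega)
    have hpm : (2⁻¹ : ℝ≥0∞) ^ (m + 1) ≤ 2⁻¹ ^ (N + 1) :=
      pow_le_pow_right_of_le_one' (by norm_num) (by omega)
    have hsum : (2⁻¹ : ℝ≥0∞) ^ (N + 1) + 2⁻¹ ^ (N + 1) = 2⁻¹ ^ N := by
      rw [← two_mul, pow_succ, mul_comm (2 : ℝ≥0∞), mul_assoc,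
        ENNReal.inv_mul_cancel (by norm_num) (by norm_num), mul_one]
    calc eLpNorm (f n - f m) (3 / 2 : ℝ≥0∞) μ' ≤ W * (D (φ n) + D (φ m)) := h
      _ ≤ W * (2⁻¹ ^ (n + 1) + 2⁻¹ ^ (m + 1)) := by gcongr <;> apply hφ
      _ ≤ W * (2⁻¹ ^ (N + 1) + 2⁻¹ ^ (N + 1)) := by gcongr
      _ = W * 2⁻¹ ^ N := by rw [hsum]
      _ < B N := by
          rw [hB_def]; dsimp only
          rw [add_mul, one_mul]
          exact ENNReal.lt_add_right (ENNReal.mul_ne_top hWtop (ENNReal.pow_ne_top (by norm_num)))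
            (hhalf N).ne'
  -- the a.e. limit
  have hlim := MeasureTheory.Lp.ae_tendsto_of_cauchy_eLpNorm hfm h1le hB hcau
  obtain ⟨P, hPm, hP⟩ := exists_stronglyMeasurable_limit_of_tendsto_ae hfm hlim
  refine ⟨P, hPm, ?_⟩
  -- slices
  rw [hμ', volume_restrict_Ioo_prod_univ_eq_prod] at hP
  have hP' := Measure.ae_ae_of_ae_prod hP
  filter_upwards [hP', ae_restrict_mem measurableSet_Ioo] with t ht htI
  have htI' : t ∈ Ico 0 S := ⟨htI.1.le, htI.2⟩
  have hT : Tendsto (fun j => eLpNorm (stepRieszPressure u S (φ j) t - rieszPressure (u t))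
      (3 / 2 : ℝ≥0∞) volume) atTop (𝓝 0) :=
    tendsto_of_tendsto_of_tendsto_of_le_of_le tendsto_const_nhds (hD.comp hφmono.tendsto_atTop)
      (fun _ => bot_le) (fun j => hDle _ t htI')
  have hIM := tendstoInMeasure_of_tendsto_eLpNorm (by norm_num)
    (fun j => aestronglyMeasurable_stepRieszPressure_slice u S (φ j) t)
    (aestronglyMeasurable_rieszPressure' _) hT
  obtain ⟨ψ, hψ, hψae⟩ := hIM.exists_seq_tendsto_ae
  filter_upwards [ht, hψae] with x hx1 hx2
  exact tendsto_nhds_unique (hx1.comp hψ.tendsto_atTop) hx2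

end Limit

/-! ### The space–time pressure with its classes and the weak Poisson equation -/

section Main

variable {S : ℝ} {u : ℝ → ℝ³ → ℝ³}

/-- **The space–time Riesz pressure of a `C([0,S]; L³)` velocity: existence with all the classes
used by the local Leray theory.** For `0 < S` and `u ∈ C([0,S]; L³(ℝ³; ℝ³))` there is
`p : ℝ → ℝ³ → ℝ`, jointly measurable on `(0,S) × ℝ³`, with `p ∈ L^{3/2}((0,S) × ℝ³)`, and for
a.e. `t ∈ (0,S)`: `p(t) ∈ L^{3/2}` with Stein's bound `‖p(t)‖_{L^{3/2}} ≤ C_{3/2} ‖u(t)‖²_{L³}` and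
the weak pressure Poisson equation `∫ p(t) Δφ = -∫ D²φ(u(t), u(t))` for all test functions `φ`
(`-Δp = Σᵢⱼ ∂ᵢ∂ⱼ(uᵢuⱼ)`; Lemarié-Rieusset 2016, Prop. 6.5 with Def. 6.9 and Prop. 6.2:
`∇p = -(Id - ℙ) div(u ⊗ u)`, `p = Σ ℛᵢℛⱼ(uᵢuⱼ) ∈ L^∞((0,S), L^{3/2})`; Stein 1970, Ch. II §4.2
Thm. 3). The slices are the tree's Riesz pressures `Π[u(t)]` (`RieszPressureL3.lean`).
[cite: LemarieRieusset2016, Prop. 6.5 with Def. 6.9 (file p. 136) and Prop. 6.2 (p. 130)]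
[cite: Stein1971, Ch. II §4.2 Thm. 3] -/
theorem exists_spaceTime_rieszPressure (hS : 0 < S) (hu : ContinuousInLpOn (Icc 0 S) 3 u) :
    ∃ p : ℝ → ℝ³ → ℝ,
      AEStronglyMeasurable (uncurry p) (volume.restrict (Ioo 0 S ×ˢ (univ : Set ℝ³))) ∧
      MemLp (uncurry p) (3 / 2 : ℝ≥0∞) (volume.restrict (Ioo 0 S ×ˢ (univ : Set ℝ³))) ∧
      ∀ᵐ t ∂(volume.restrict (Ioo 0 S)),
        p t =ᵐ[volume] rieszPressure (u t) ∧
        MemLp (p t) (3 / 2 : ℝ≥0∞) volume ∧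
        eLpNorm (p t) (3 / 2 : ℝ≥0∞) volume ≤ steinConstThreeHalves * eLpNorm (u t) 3 volume ^ 2 ∧
        ∀ φ : ℝ³ → ℝ, ContDiff ℝ (⊤ : ℕ∞) φ → HasCompactSupport φ →
          ∫ x, p t x * (Δ φ) x = -∫ x, fderiv ℝ (fderiv ℝ φ) x (u t x) (u t x) := by
  obtain ⟨P, hPm, hP⟩ := exists_stronglyMeasurable_slice_ae_eq_rieszPressure hS hu
  obtain ⟨M, hM⟩ := hu.exists_forall_eLpNorm_le_Icc
  set p : ℝ → ℝ³ → ℝ := fun t x => P (t, x) with hp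
  have hpP : uncurry p = P := by funext z; rfl
  -- slice properties for a.e. `t`
  have hsl : ∀ᵐ t ∂(volume.restrict (Ioo 0 S)),
      p t =ᵐ[volume] rieszPressure (u t) ∧
        MemLp (p t) (3 / 2 : ℝ≥0∞) volume ∧
        eLpNorm (p t) (3 / 2 : ℝ≥0∞) volume ≤ steinConstThreeHalves * eLpNorm (u t) 3 volume ^ 2 ∧
        ∀ φ : ℝ³ → ℝ, ContDiff ℝ (⊤ : ℕ∞) φ → HasCompactSupport φ →
          ∫ x, p t x * (Δ φ) x = -∫ x, fderiv ℝ (fderiv ℝ φ) x (u t x) (u t x) := by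
    filter_upwards [hP, ae_restrict_mem measurableSet_Ioo] with t ht htI
    have hut : MemLp (u t) 3 volume := hu.1 t ⟨htI.1.le, htI.2.le⟩
    have hR := memLp_rieszPressure hut
    refine ⟨ht, hR.ae_eq ht.symm, ?_, fun φ hφ hφc => ?_⟩
    · rw [eLpNorm_congr_ae ht]
      exact eLpNorm_rieszPressure_le hut
    · rw [← integral_rieszPressure_mul_laplacian hut hφ hφc]
      refine integral_congr_ae ?_
      filter_upwards [ht] with x hx
      show P (t, x) * _ = _
      rw [hx]
  -- the space–time class
  have hmeas : AEStronglyMeasurable (uncurry p) (volume.restrict (Ioo 0 S ×ˢ (univ : Set ℝ³))) := by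
    rw [hpP]; exact hPm.aestronglyMeasurable
  refine ⟨p, hmeas, ⟨hmeas, ?_⟩, hsl⟩
  -- `∫∫ |p|^{3/2} ≤ S (C M²)^{3/2} < ∞`
  have h32 : (3 / 2 : ℝ≥0∞) ≠ 0 := by norm_num
  have h32' : (3 / 2 : ℝ≥0∞) ≠ ⊤ := by
    rw [ENNReal.div_eq_inv_mul]; exact ENNReal.mul_ne_top (by simp) (by simp)
  have e32 : (3 / 2 : ℝ≥0∞).toReal = 3 / 2 := by rw [ENNReal.toReal_div]; norm_num
  rw [eLpNorm_lt_top_iff_lintegral_rpow_enorm_lt_top h32 h32', e32, volume_restrict_Ioo_prod_univ_eq_prod,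
    lintegral_prod _ ?_]
  · set K : ℝ≥0∞ := (steinConstThreeHalves * (M : ℝ≥0∞) ^ 2) ^ (3 / 2 : ℝ) with hK
    calc ∫⁻ t in Ioo 0 S, ∫⁻ x, ‖uncurry p (t, x)‖ₑ ^ (3 / 2 : ℝ)
        ≤ ∫⁻ _ in Ioo 0 S, K := by
          refine lintegral_mono_ae ?_
          filter_upwards [hsl, ae_restrict_mem measurableSet_Ioo] with t ht htI
          obtain ⟨-, -, hle, -⟩ := ht
          rw [show (fun x => ‖uncurry p (t, x)‖ₑ ^ (3 / 2 : ℝ)) = fun x => ‖p t x‖ₑ ^ (3 / 2 : ℝ)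
            from rfl, lintegral_enorm_rpow_threeHalves_eq, hK]
          refine ENNReal.rpow_le_rpow (hle.trans ?_) (by norm_num)
          gcongr
          exact hM t ⟨htI.1.le, htI.2.le⟩
      _ < ⊤ := by
          rw [lintegral_const, Measure.restrict_apply_univ, Real.volume_Ioo]
          exact ENNReal.mul_lt_top (ENNReal.rpow_lt_top_of_nonneg (by norm_num)
            (ENNReal.mul_ne_top ENNReal.coe_ne_top (ENNReal.pow_ne_top ENNReal.coe_ne_top)))
            ENNReal.ofReal_lt_top
  · rw [hpP]
    exact (hPm.measurable.enorm.pow_const _).aemeasurable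

end Main

end Literature.Analysis.FluidPDE
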